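import Summits.BirchSwinnertonDyer.Rank1Residual.X12.O11.RamifiedRubinFormulaLine
import Literature.NumberTheory.EllipticCurves.IwasawaSelmerProofs
import HarnessLib

set_option linter.dupNamespace false
set_option autoImplicit false

/-!
# Route `RamifiedSevenEllipticUnits` (rung K7r), value crux `EllipticUnitValueSeven`
# (stmt-BirchSwinnertonDyer-19705), line `rubin-formula`, stub S_B4 `stub_bottomLocalIndexSplitSeven`:
# KERNEL READING of the registered stub, I — what its conclusion forces (`--supports 19705`)

Cell `bsd-cm`, seat `bsd-cm-k7r-c2` g4 (director 2026-08-26T16:56Z «k7r-c2 and k7r-c4 work 19705»; claim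
posted on the cell STATUS 17:43Z). HONEST FRAMING: nothing here closes the stub, the crux, the leaf or any
item; BSD is not proved; no named fact is minted; every theorem is `sorry`-free. Companion file
`RamifiedSevenEllipticUnitsBottomLocalIndexSplitInputs.lean` (II: the index bookkeeping and the inputs).

## What the registered stub says

S_B4 = `X12.O11.RamifiedCMBottomLocalIndexSplitAt W p` (`RamifiedRubinFormulaLine.lean`, p450558): at
every analytic-rank-one O11 frame, for EVERY anticyclotomic elliptic-unit class datum
`D : EllipticUnitClassData W p K 𝔭 κ γ ι φ Ω 𝓔` with global bottom index exponent `c`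
(`D.HasBottomIndexExp c`) satisfying the IMC identity, and every local Mordell–Weil index exponent `m`
(`HasBottomLocalMordellWeilIndexExp … m`): `D.HasLocalBottomIndexExp (c + m)`. By definition
(`LocalBottomIndex.lean`, `HasLocalIndexExpOfEmb`) that conclusion is a conjunction: (α)
`loc_𝔭(𝒪 · z(𝟙)) ≤ E(K_𝔭) ⊗ ℤ_p` (the `End_K`-span of the bottom class localises INTO the local Kummer
compact group) and (β) the index identity `[E(K_𝔭) ⊗ ℤ_p : tors + loc_𝔭(𝒪 · z(𝟙))] = p^{c+m}`.

## What this file proves (all PROVED)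

* Part 1 (generic, any base field): a Kummer class of the local curve dies in `H¹(H', E(K̄_E))`
  (`torsionToPointsH1_kummerClassOver`), hence every element of the local Kummer compact group
  `localKummerCompactOfEmb` is LEVEL-WISE a local Kummer class
  (`torsionToPointsH1_apply_eq_zero_of_mem_localKummerCompactOfEmb`).
* Part 2 (reading (α) back): if a datum `D` HAS a local bottom index exponent `λ₀` at all, then its
  bottom class `z(𝟙)` is Kummer above `𝔭` (`mem_localKummerPi_of_hasLocalBottomIndexExp`), lies in the
  FULL compact Selmer group `S_p(E/K)` (`bottom_mem_compactSelmerOver_of_hasLocalBottomIndexExp` — the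
  CONVERSE of seat ram's B1 `BottomClass.bottom_mem_compactSelmerOver`, p446875), and — through the
  datum's exact-kernel reading `δ_eq_zero_iff` and explicit reciprocity law `erl` — every level-`0`
  central value reading vanishes: `L(φχ, 1) = 0 ∨ Ω = 0`
  (`centralValue_eq_zero_or_period_eq_zero_of_hasLocalBottomIndexExp`).
* Part 3 (the WITNESS): consequently S_B4, as registered, IMPLIES that vanishing for every datum with
  finite global and local Mordell–Weil index exponents (`centralValue_eq_zero_of_localIndexSplitAt`) —
  although `φ` and `Ω` are FREE binders of S_B4 (no clause ties `φ` to `W`; the tree's only pin is the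
  clause `heckeLFunction φ s = W.LSeries s` of `RubinEllipticUnitClasses`, absent from the stub): the
  stub carries B1's HYPOTHESIS `hvan` as a CONCLUSION. This is the kernel form of the seat's finding
  «S_B4 is not closable as registered» (memo `SB4-RECUT.md`, evidence on 19705): (α) is not derivable
  from S_B4's binders; a re-cut must carry `hvan` (or a `φ`-pinning clause) as a binder, or state only
  (β) in `∀ λ₀`-form — whose inputs the companion file names.

References: [BKNO] arXiv:2608.06879v1 §3.1.2, Prop. 4.10, Lemma 7.1, Thm. 7.2, §1.4
[BurungaleKobayashiNakamuraOta2026]; S. Bloch, K. Kato (1990) (3.8), Ex. 3.11 [BlochKato1990];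
B. Perrin-Riou, Bull. SMF 115 (1987) §0 [PerrinRiou1987BSMF]; J.-P. Serre, *Local Fields* VII.§5 Prop. 3
[SerreLocalFields1979]; J. H. Silverman, *AEC* VIII.§2 [SilvermanAEC2009]; cell memos
BETA-DESIGN-ram-g7.md §7, BRIEF-k7r-split.md, SB4-RECUT.md (this seat).
-/

noncomputable section

open scoped Classical

open WeierstrassCurve NumberField IsDedekindDomain Field
  Literature.NumberTheory.EllipticCurves
  Literature.NumberTheory.EllipticCurves.Rank1Residual
  Literature.NumberTheory.GaloisRepresentations
  Literature.NumberTheory.EllipticCurves.Castella2018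
  Literature.NumberTheory.EllipticCurves.BurungaleKobayashiNakamuraOta2026
  Summit.BirchSwinnertonDyer.Rank1Residual
  Summit.BirchSwinnertonDyer.Rank1Residual.X12

universe u

namespace Summit.BirchSwinnertonDyer.BirchSwinnertonDyer.Theorems.RamifiedSevenEllipticUnits

namespace LocalIndexSplitReading

/-! ## Part 1. Local Kummer classes die in `H¹(H', E(K̄_E))`; the local Kummer compact group is
level-wise Kummer (any base field) -/

section Generic

variable {K : Type u} [Field K] (W : WeierstrassCurve K)
variable {E : Type u} [Field E] [Algebra K E] (ι : AlgebraicClosure K →ₐ[K] AlgebraicClosure E)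

/-- **A Kummer class of the local curve dies in `H¹(H', E(K̄_E))`**: for `Q ∈ E(K̄_E)` with `m • Q`
fixed by `H'`, the image of `δ(m • Q) = [σ ↦ σQ − Q] ∈ H¹(H', E[m](K̄_E))` under the coefficient map
`E[m] ⊆ E(K̄_E)` (`torsionToPointsH1`) is the coboundary of `Q`, hence zero — exactness of the Kummer
sequence `E(F) → H¹(F, E[m]) → H¹(F, E)` at the middle term, local field case. Silverman, *AEC*,
VIII.§2 (the Kummer sequence) read over `K̄_E`. [cite: SilvermanAEC2009, VIII.§2 (the Kummer sequence, Prop. 2.1 setting)] -/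
theorem torsionToPointsH1_kummerClassOver (m : ℤ) (H' : Subgroup (Field.absoluteGaloisGroup E))
    (Q : geomPoints (W.baseChange E)) (hQ : ∀ σ ∈ H', σ • (m • Q) = m • Q) :
    W.torsionToPointsH1 m H' ((W.baseChange E).kummerClassOver H' m Q hQ) = 0 := by
  rw [WeierstrassCurve.torsionToPointsH1, WeierstrassCurve.kummerClassOver]
  refine (map_oneCocycleClass (X := discreteTopRep H' (geomTorsion (W.baseChange E) m))
    (Y := discreteTopRep H' (localPoints W E)) (ContinuousMonoidHom.id H') (resHomOfEquivariant _ _ _)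
    ((W.baseChange E).kummerCocycleOver H' m Q hQ)).trans ?_
  rw [oneCocycleClass_eq_zero_iff]
  refine ⟨W.geomPointsToLocalPoints (E := E) Q, fun σ ↦ ?_⟩
  change W.geomPointsToLocalPoints ((((W.baseChange E).kummerCocycleOver H' m Q hQ).1 σ :
      geomTorsion (W.baseChange E) m) : geomPoints (W.baseChange E)) =
    (σ : Field.absoluteGaloisGroup E) • W.geomPointsToLocalPoints (E := E) Q -
      W.geomPointsToLocalPoints (E := E) Q
  rw [coe_kummerCocycleOver_apply, map_sub, Subgroup.smul_def, geomPointsToLocalPoints_smul]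

variable (p : ℕ) [Fact p.Prime] (H : Subgroup (Field.absoluteGaloisGroup K))

variable {W ι p H} in
/-- **The local Kummer compact group is level-wise Kummer**: every element `x` of
`localKummerCompactOfEmb ι p H = E(L·E) ⊗ ℤ_p` (the `ℤ_p`-span of the Kummer families of the
`H_E`-fixed local points) has all its components killed by `H¹(H_E, E[p^k]) → H¹(H_E, E(K̄_E))`
(generators: `c · d` with `d` the Kummer family of a local point, whose components are Kummer classes
of roots — roots exist on the local curve, `zsmul_geomPoints_surjective_holds`; then closure induction).
Bloch–Kato Ex. 3.11 (`H¹_f` = Kummer image) at finite level. [cite: BlochKato1990, Example 3.11]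
[cite: SilvermanAEC2009, VIII.§2 (the Kummer sequence)] -/
theorem torsionToPointsH1_apply_eq_zero_of_mem_localKummerCompactOfEmb [W.IsElliptic]
    {x : (W.baseChange E).torsionH1Pi p (localSubgroupOfEmb H ι)}
    (hx : x ∈ W.localKummerCompactOfEmb ι p H) (k : ℕ) :
    W.torsionToPointsH1 ((p : ℤ) ^ k) (localSubgroupOfEmb H ι) (x k) = 0 := by
  unfold WeierstrassCurve.localKummerCompactOfEmb WeierstrassCurve.mordellWeilKummerSpan
    WeierstrassCurve.kummerSpan at hx
  induction hx using AddSubgroup.closure_induction with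
  | mem x hx =>
    obtain ⟨P, hPS, c, d, hd, rfl⟩ := hx
    have hpk : ((p : ℤ) ^ k) ≠ 0 :=
      pow_ne_zero _ (Int.natCast_ne_zero.mpr (Fact.out : p.Prime).ne_zero)
    obtain ⟨Q, hQ⟩ := (W.baseChange E).zsmul_geomPoints_surjective_holds hpk P
    have hQ' : ((p : ℤ) ^ k) • Q = P := hQ
    simp only [WeierstrassCurve.padicPi, AddMonoidHom.pi_apply, AddMonoidHom.coe_comp,
      Function.comp_apply, Pi.evalAddMonoidHom_apply, zsmulAddGroupHom_apply, map_zsmul]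
    rw [hd k Q hQ', torsionToPointsH1_kummerClassOver]
    exact zsmul_zero _
  | zero => rw [Pi.zero_apply, map_zero]
  | add x y _ _ hx hy => rw [Pi.add_apply, map_add, hx, hy, add_zero]
  | neg x _ hx => rw [Pi.neg_apply, map_neg, hx, neg_zero]

end Generic

/-! ## Part 2. A datum that HAS a local bottom index exponent has a crystalline bottom class, and
then its level-`0` central values vanish (or `Ω = 0`) -/

section Bottom

variable {W : WeierstrassCurve ℚ} [W.IsElliptic] {p : ℕ} [Fact p.Prime]
  {K : Type} [Field K] [NumberField K] {𝔭 : HeightOneSpectrum (𝓞 K)}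
  {κ : ZpExtension K p} {γ : absoluteGaloisGroup K}
  {ι : PadicAlgCl p ≃+* ℂ} {φ : HeckeCharacter K} {Ω : ℂ} {𝓔 : AcDualExpSystem W p K 𝔭 κ ι}

/-- **(α) read back: a local bottom index exponent exists only if `z(𝟙)` is Kummer above `𝔭`.**
If `D.HasLocalBottomIndexExp l` for some `l`, then the bottom class `z(𝟙) = D.z 0` lies in
`localKummerPi (κ.layerSubgroup 0) p {𝔭}` — its every component is a local Kummer class at `𝔭`
(first conjunct of `HasLocalIndexExpOfEmb`: `loc_𝔭(𝒪·z(𝟙)) ≤ E(K_𝔭) ⊗ ℤ_p`, then Part 1, the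
factorisation `localResTorsionOverOfEmb = torsionToPointsH1 ∘ localTorsionResOfEmb`, and the triviality
of conjugation on `H¹(Γ_K, ·)` = Serre, *Local Fields*, VII.§5 Prop. 3). [cite: SerreLocalFields1979, VII.§5 Prop. 3]
[cite: BlochKato1990, Example 3.11] -/
theorem mem_localKummerPi_of_hasLocalBottomIndexExp (D : EllipticUnitClassData W p K 𝔭 κ γ ι φ Ω 𝓔)
    {l : ℕ} (hl : D.HasLocalBottomIndexExp l) :
    D.z 0 ∈ (W.baseChange K).localKummerPi (κ.layerSubgroup 0) p {𝔭} := by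
  have hloc := fun k ↦ torsionToPointsH1_apply_eq_zero_of_mem_localKummerCompactOfEmb
    (hl.1 ((W.baseChange K).localTorsionResPi_mem_localEndSpanOfEmb _ p _ (D.z 0))) k
  rw [mem_localKummerPi_iff]
  intro k
  rw [mem_localKummerTorsionOver_iff]
  intro v hv σ
  rw [Set.mem_singleton_iff] at hv
  subst hv
  have hσ : σ ∈ κ.layerSubgroup 0 := by
    rw [ZpExtension.layerSubgroup_zero]; trivial
  rw [Literature.NumberTheory.EllipticCurves.conjH1_of_mem_holds (κ.layerSubgroup 0)
      (geomTorsion (W.baseChange K) ((p : ℤ) ^ k)) hσ, AddMonoidHom.id_apply,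
    localResTorsionOverOfEmb_eq_comp, AddMonoidHom.coe_comp, Function.comp_apply,
    ← localTorsionResPi_apply]
  exact hloc k

/-- **Converse of seat ram's B1**: a datum that has a local bottom index exponent has its bottom class
in the FULL compact Selmer group `S_p(E/K)` (relaxed at `𝔭` by `z_mem`, Kummer at `𝔭` by the previous
theorem; `relaxed ⊓ localKummer = compact`). [BKNO] Lemma 7.1 read backwards through the cell's
carriers. [cite: BurungaleKobayashiNakamuraOta2026, Lemma 7.1 and §3.1.2 (arXiv:2608.06879 pp. 16, 40) (claim; preprint; shape only)] -/
theorem bottom_mem_compactSelmerOver_of_hasLocalBottomIndexExp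
    (D : EllipticUnitClassData W p K 𝔭 κ γ ι φ Ω 𝓔) {l : ℕ} (hl : D.HasLocalBottomIndexExp l) :
    D.z 0 ∈ (W.baseChange K).compactSelmerOver (κ.layerSubgroup 0) p := by
  rw [← (W.baseChange K).relaxedCompactSelmerOver_inf_localKummerPi (κ.layerSubgroup 0) p {𝔭}]
  exact ⟨D.z_mem 0, mem_localKummerPi_of_hasLocalBottomIndexExp D hl⟩

/-- **All level-`0` dual-exponential readings of `z(𝟙)` vanish** when a local bottom index exponent
exists (exact-kernel reading `δ_eq_zero_iff` of the datum `𝓔`, on the compatible family `z(𝟙)`).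
[cite: BurungaleKobayashiNakamuraOta2026, §4.4 (4.10) (arXiv:2608.06879 p. 31) (claim; preprint; shape only)]
[cite: BlochKato1990, (3.8) and Example 3.11] -/
theorem δ_bottom_eq_zero_of_hasLocalBottomIndexExp (D : EllipticUnitClassData W p K 𝔭 κ γ ι φ Ω 𝓔)
    {l : ℕ} (hl : D.HasLocalBottomIndexExp l) {χ : HeckeCharacter K}
    {r : FramedGaloisRep K (PadicAlgCl p) 1} (h : IsAcCharacter ι κ 0 χ r) : 𝓔.δ 0 r (D.z 0) = 0 :=
  (𝓔.δ_eq_zero_iff 0 (D.z 0) (mem_relaxedCompactSelmerOver_iff.1 (D.z_mem 0)).2).2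
    (mem_localKummerPi_of_hasLocalBottomIndexExp D hl) χ r h

/-- **The reading of (α) in `L`-values: a local bottom index exponent exists only if every level-`0`
central value vanishes, `L(φχ, 1) = 0`, or the period is `Ω = 0`.** From the previous theorem and the
explicit reciprocity law `erl` (`δ 0 r (z 0) = ι⁻¹(L(φχ,1)/Ω)`). NOTE: `φ` and `Ω` are PARAMETERS of
the datum, tied to `W` by nothing in the carrier; this is exactly the hypothesis `hvan` of seat ram's B1
`BottomClass.bottom_mem_compactSelmerOver` (p446875), here obtained as a CONSEQUENCE of the existence of
`λ₀(D)`. [cite: BurungaleKobayashiNakamuraOta2026, Prop. 4.10 and Lemma 7.1 (arXiv:2608.06879 pp. 31, 40) (claim; preprint; shape only)] -/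
theorem centralValue_eq_zero_or_period_eq_zero_of_hasLocalBottomIndexExp
    (D : EllipticUnitClassData W p K 𝔭 κ γ ι φ Ω 𝓔) {l : ℕ} (hl : D.HasLocalBottomIndexExp l)
    {χ : HeckeCharacter K} {r : FramedGaloisRep K (PadicAlgCl p) 1} (h : IsAcCharacter ι κ 0 χ r)
    (hL : LFunction.HasEntireContinuation (heckeLFunction (φ * χ))) :
    hL.continuation 1 = 0 ∨ Ω = 0 := by
  have h0 := δ_bottom_eq_zero_of_hasLocalBottomIndexExp D hl h
  rw [D.erl 0 χ r h hL] at h0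
  rw [PadicComplex.coe_eq, map_eq_zero_iff _ (algebraMap (PadicAlgCl p) ℂ_[p]).injective,
    map_eq_zero_iff _ ι.symm.injective, div_eq_zero_iff] at h0
  exact h0

end Bottom

/-! ## Part 3. THE WITNESS: S_B4 as registered forces the level-`0` vanishing for every datum with
finite indices — B1's hypothesis appears as a conclusion of the stub -/

section Witness

variable {W : WeierstrassCurve ℚ} [W.IsElliptic] [W.IsGloballyMinimal] {p : ℕ} [Fact p.Prime]

omit [W.IsGloballyMinimal] in
/-- **S_B4 ⟹ vanishing of the level-`0` central values of the FREE character `φ`** (or `Ω = 0`), for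
every framed pair of analytic rank one, every anticyclotomic tower with generator, and EVERY datum
`(ι, φ, Ω, 𝓔, D)` with a global bottom index exponent `c` satisfying the IMC identity, as soon as ONE
local Mordell–Weil index exponent `m` exists. Proof: S_B4 gives `D.HasLocalBottomIndexExp (c + m)`,
then Part 2. READING (the seat's finding, memo SB4-RECUT.md): nothing among S_B4's binders ties `φ`
or `Ω` to `W` (the only pin in the tree is the clause `heckeLFunction φ s = W.LSeries s` of
`RubinEllipticUnitClasses`, absent here), so the conjunct (α) of S_B4's conclusion — equivalently this
vanishing — is not derivable from them: S_B4 is not closable as registered; it must either carry B1's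
`hvan` (or a `φ`-pinning clause) as a binder, or be re-cut to the identity (β) in `∀ λ₀`-form.
[cite: BurungaleKobayashiNakamuraOta2026, Lemma 7.1, Thm. 7.2 and §1.4 (arXiv:2608.06879 pp. 8, 40–41) (claim; preprint; shape only)] -/
theorem centralValue_eq_zero_of_localIndexSplitAt (hS : O11.RamifiedCMBottomLocalIndexSplitAt W p)
    {K : Type} [Field K] [NumberField K] {𝔭 : HeightOneSpectrum (𝓞 K)}
    {W' : WeierstrassCurve ℚ} [W'.IsElliptic] [W'.IsGloballyMinimal] {C : VariableChange ℚ}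
    (hF : O11.IsFrame W p K 𝔭 W' C) (hr : W.analyticRank = 1)
    {κ : ZpExtension K p} (hκ : κ.IsAnticyclotomic) (γ : absoluteGaloisGroup K)
    [Fact (κ.IsTopGenerator γ)] {ι : PadicAlgCl p ≃+* ℂ} {φ : HeckeCharacter K} {Ω : ℂ}
    {𝓔 : AcDualExpSystem W p K 𝔭 κ ι} (D : EllipticUnitClassData W p K 𝔭 κ γ ι φ Ω 𝓔) {c : ℕ}
    (hc : D.HasBottomIndexExp c)
    (himc : ∀ (n₀ : ℕ), AcSelmer.XAc.HasCharValuationAt (W.baseChange K) p κ 𝔭 ∅ γ n₀ →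
      Finite {x : AcSelmer.XAc (W.baseChange K) p κ 𝔭 ∅ γ //
        (PowerSeries.X : IwasawaAlgebra p) • x = 0} →
      (n₀ : ℤ) + padicValNat p (Nat.card {x : AcSelmer.XAc (W.baseChange K) p κ 𝔭 ∅ γ //
          (PowerSeries.X : IwasawaAlgebra p) • x = 0}) = c)
    {m : ℕ} (hm : HasBottomLocalMordellWeilIndexExp W p K 𝔭 κ m)
    {χ : HeckeCharacter K} {r : FramedGaloisRep K (PadicAlgCl p) 1} (h : IsAcCharacter ι κ 0 χ r)
    (hL : LFunction.HasEntireContinuation (heckeLFunction (φ * χ))) :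
    hL.continuation 1 = 0 ∨ Ω = 0 :=
  centralValue_eq_zero_or_period_eq_zero_of_hasLocalBottomIndexExp D
    (hS K 𝔭 W' C hF hr κ hκ γ ι φ Ω 𝓔 D c hc himc m hm) h hL

omit [W.IsGloballyMinimal] in
/-- **Corollary for a NON-vanishing parameter**: if some level-`0` character `χ` has an entire
continuation of `L(φχ, s)` with `L(φχ, 1) ≠ 0` and `Ω ≠ 0`, then under S_B4 NO datum over
`(ι, φ, Ω, 𝓔)` has both a global bottom index exponent with the IMC identity and a local Mordell–Weil
index exponent — the stub legislates about data it was never meant to mention (junk-refutable in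
principle, BETA-DESIGN-ram-g7.md §2 taxonomy), though no such datum is constructible in the tree.
[cite: BurungaleKobayashiNakamuraOta2026, Prop. 4.10 (arXiv:2608.06879 p. 31) (claim; preprint; shape only)] -/
theorem not_hasBottomIndexExp_of_localIndexSplitAt_of_centralValue_ne_zero
    (hS : O11.RamifiedCMBottomLocalIndexSplitAt W p)
    {K : Type} [Field K] [NumberField K] {𝔭 : HeightOneSpectrum (𝓞 K)}
    {W' : WeierstrassCurve ℚ} [W'.IsElliptic] [W'.IsGloballyMinimal] {C : VariableChange ℚ}
    (hF : O11.IsFrame W p K 𝔭 W' C) (hr : W.analyticRank = 1)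
    {κ : ZpExtension K p} (hκ : κ.IsAnticyclotomic) (γ : absoluteGaloisGroup K)
    [Fact (κ.IsTopGenerator γ)] {ι : PadicAlgCl p ≃+* ℂ} {φ : HeckeCharacter K} {Ω : ℂ} (hΩ : Ω ≠ 0)
    {χ : HeckeCharacter K} {r : FramedGaloisRep K (PadicAlgCl p) 1} (h : IsAcCharacter ι κ 0 χ r)
    (hL : LFunction.HasEntireContinuation (heckeLFunction (φ * χ))) (hL1 : hL.continuation 1 ≠ 0)
    {𝓔 : AcDualExpSystem W p K 𝔭 κ ι} (D : EllipticUnitClassData W p K 𝔭 κ γ ι φ Ω 𝓔) {c : ℕ}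
    (hc : D.HasBottomIndexExp c)
    (himc : ∀ (n₀ : ℕ), AcSelmer.XAc.HasCharValuationAt (W.baseChange K) p κ 𝔭 ∅ γ n₀ →
      Finite {x : AcSelmer.XAc (W.baseChange K) p κ 𝔭 ∅ γ //
        (PowerSeries.X : IwasawaAlgebra p) • x = 0} →
      (n₀ : ℤ) + padicValNat p (Nat.card {x : AcSelmer.XAc (W.baseChange K) p κ 𝔭 ∅ γ //
          (PowerSeries.X : IwasawaAlgebra p) • x = 0}) = c)
    {m : ℕ} (hm : HasBottomLocalMordellWeilIndexExp W p K 𝔭 κ m) : False := by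
  rcases centralValue_eq_zero_of_localIndexSplitAt hS hF hr hκ γ D hc himc hm h hL with h0 | h0
  · exact hL1 h0
  · exact hΩ h0

end Witness

end LocalIndexSplitReading

end Summit.BirchSwinnertonDyer.BirchSwinnertonDyer.Theorems.RamifiedSevenEllipticUnits

end
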